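import Mathlib
import Literature.AlgebraicGeometry.Resolution.RegularLocalRingsProofs
import HarnessLib

/-!
# Crux `Steer` (stmt-ResolutionOfSingularities-16345), line `switching_dichotomy` — G `GeoDict` sub-piece (g2):
# ISOLATEDNESS OF THE TRANSVERSAL TORSOR GERM FROM MINIMALITY OF THE CENTRE

Helper for the σ-line piece **G `GeoDict`** of chain W4.1 (res-L0-w41-plan-1 ORDER 2026-08-27T05:03:22Z,
CHAIN v5.4 §B1 / v5.4a; holder res-D-pv-011 AS res-L0-w41-stub-7, cut (g0)–(g4) 05:24:11Z; this file = (g2), named to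
res-type-096). OURS (a statement about the route's own objects — the radicand rings `S[T]/(T^p − f)` of
res-L0-w41-plan-1's `Sketch-R2-steered.lean` §3.1–§3.2; it replaces nothing of and is NOT a statement of the
manuscript under review in cell res-hironaka).

In the sketch's vocabulary (`RadicandRing S p f := AdjoinRoot (X ^ p − C f)`, `IsSingPrime R p f Q := ¬ IsRegularLocalRing
(RadicandRing R_Q p f)`, `HasIsolatedSingularity B := ∀ P non-maximal prime, IsRegularLocalRing B_P`, `IsTopSingComponent`'s
minimality clause «no singular prime strictly below `P`»), the theorem below reads: **if no prime `Q < P` of the base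
`R` is a singular prime of the radicand `f`, then the torsor germ `R_P[T]/(T^p − f)` over the local ring of the base at
`P` has an isolated singularity** — with `RadicandRing` / `HasIsolatedSingularity` UNFOLDED and `R_P` any
`IsLocalization.AtPrime S' P` (signature fixed with the G holder so that the assembly meets it by `exact`).

Proof (commutative algebra, no geometry): let `B := S'[T]/(T^p − f)` and `P'` a non-maximal prime of `B`.
* `B` is module-finite over `S'` (monic generator), so by integrality (`Ideal.isMaximal_of_isIntegral_of_isMaximal_comap`)
  the prime `q := P' ∩ S'` is not maximal; `S'` being local with maximal ideal `P S'`, the prime `Q := q ∩ R` satisfies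
  `Q < P` (`IsLocalization.map_under`, `IsLocalization.AtPrime.map_eq_maximalIdeal`) — `under_under_lt_of_exists_lt`.
* Since `Q ≤ P`, the ring `C := R_Q[T]/(T^p − f)` is a LOCALISATION of `B` at the image `N` of `R ∖ Q`: `R_Q` is the
  localisation of `S'` at the image of `R ∖ Q` (`IsLocalization.isLocalization_of_submonoid_le`), polynomial rings and
  quotients commute with localisation (`Polynomial.isLocalization`, `IsLocalization.of_surjective`).
* `N` misses `P'` (its elements come from `R ∖ Q`, and `P' ∩ R = Q`), so `P'C` is a prime of `C` lying over `P'` and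
  `B_{P'}` is the localisation of `C` at `P'C` (`IsLocalization.isLocalization_isLocalization_atPrime_isLocalization`);
  `C` is a regular local ring by the hypothesis at `Q < P`, hence so is its localisation at a prime — Serre's theorem,
  Matsumura 19.3, tree `Literature.AlgebraicGeometry.Resolution.isRegularLocalRing_localization_atPrime` — and regularity
  transports along `B_{P'} ≅ C_{P'C}` (`IsLocalization.algEquiv`, `IsRegularLocalRing.of_ringEquiv`).

AI-produced helper; weaker than expert review. bears_on: LADDER-RESOLUTION L ★L-G4 W4.1.
-/

-- The namespace mirrors the chain's helper layout (`…Theorems.SwitchingDichotomy.<Piece>`) on purpose.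
set_option linter.dupNamespace false

noncomputable section

namespace Summit.ResolutionOfSingularities.ResolutionOfSingularities.Theorems.SwitchingDichotomy.GeoDict

open Polynomial IsLocalRing

universe u

variable {R : Type u} [CommRing R] (p : ℕ) [Fact p.Prime] (f : R) (P : Ideal R) [P.IsPrime]
  (S' : Type u) [CommRing S'] [Algebra R S'] [IsLocalization.AtPrime S' P]

/-- The radicand polynomial `T^p − f` over `S'` is monic. [folklore] -/
theorem monic_X_pow_sub_C_algebraMap : ((X : S'[X]) ^ p - C (algebraMap R S' f)).Monic :=
  monic_X_pow_sub_C _ (Fact.out : p.Prime).ne_zero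

/-- The radicand ring `S'[T]/(T^p − f)` is module-finite over `S'` (power basis of the monic `T^p − f`). [folklore] -/
theorem finite_adjoinRoot_X_pow_sub_C :
    Module.Finite S' (AdjoinRoot ((X : S'[X]) ^ p - C (algebraMap R S' f))) :=
  (AdjoinRoot.powerBasis' (monic_X_pow_sub_C_algebraMap p f S')).finite

/-- **The prime of the base under a non-maximal prime of the torsor germ lies STRICTLY below the centre.** For
`S' = R_P` and a prime `P'` of `B = S'[T]/(T^p − f)` that is not maximal (some prime lies strictly above it), the prime
`Q = P' ∩ R` satisfies `Q < P`: `B` is integral over the local ring `S'`, so `P' ∩ S'` is not the maximal ideal `P S'`.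
OURS. [folklore] -/
theorem under_under_lt_of_exists_lt (P' : Ideal (AdjoinRoot ((X : S'[X]) ^ p - C (algebraMap R S' f))))
    [P'.IsPrime]
    (hP' : ∃ Q' : Ideal (AdjoinRoot ((X : S'[X]) ^ p - C (algebraMap R S' f))), Q'.IsPrime ∧ P' < Q') :
    (P'.under S').under R < P := by
  haveI : Module.Finite S' (AdjoinRoot ((X : S'[X]) ^ p - C (algebraMap R S' f))) :=
    finite_adjoinRoot_X_pow_sub_C p f S'
  haveI : IsLocalRing S' := IsLocalization.AtPrime.isLocalRing S' P
  -- `P'` is not maximal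
  have hnotmax : ¬ P'.IsMaximal := by
    intro hmax
    obtain ⟨Q', hQ', hlt⟩ := hP'
    exact hlt.ne (hmax.eq_of_le hQ'.ne_top hlt.le)
  -- hence `P' ∩ S'` is not maximal (integrality)
  have hq : ¬ (P'.under S').IsMaximal := fun h =>
    hnotmax (Ideal.isMaximal_of_isIntegral_of_isMaximal_comap (R := S') P' h)
  -- `P' ∩ S' ≤ 𝔪_{S'}`, so `Q ≤ P`
  have hqle : P'.under S' ≤ maximalIdeal S' :=
    IsLocalRing.le_maximalIdeal (Ideal.IsPrime.ne_top inferInstance)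
  have hmax : (maximalIdeal S').under R = P := IsLocalization.AtPrime.under_maximalIdeal S' P
  have hle : (P'.under S').under R ≤ P := by
    have h : (P'.under S').under R ≤ (maximalIdeal S').under R := Ideal.comap_mono hqle
    rwa [hmax] at h
  refine lt_of_le_of_ne hle ?_
  intro hQP
  apply hq
  have hq' : P'.under S' = maximalIdeal S' := by
    rw [← IsLocalization.map_under P.primeCompl S' (P'.under S'), hQP,
      IsLocalization.AtPrime.map_eq_maximalIdeal P S']
  rw [hq']
  exact IsLocalRing.maximalIdeal.isMaximal S'

/-- **Core of (g2): a localised base change of the radicand ring.** Let `S' = R_P`, `Q` a prime with `R ∖ P ⊆ R ∖ Q`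
(i.e. `Q ≤ P`), `g ∈ S'[T]` any polynomial, and suppose the base change `R_Q[T]/(g)` of `B := S'[T]/(g)` along the
canonical map `S' = R_P → R_Q` is a regular local ring. Then for every prime `P'` of `B` with `P' ∩ R = Q` the
localisation `B_{P'}` is a regular local ring: `R_Q[T]/(g)` is the localisation of `B` at the image `N` of `R ∖ Q`
(`IsLocalization.isLocalization_of_submonoid_le`, `Polynomial.isLocalization`, `IsLocalization.of_surjective`), `N` misses
`P'`, so `B_{P'}` is the localisation of `R_Q[T]/(g)` at the prime `P'·R_Q[T]/(g)`
(`IsLocalization.isLocalization_isLocalization_atPrime_isLocalization`), regular by Serre's localisation theorem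
(Matsumura 19.3, tree `isRegularLocalRing_localization_atPrime`). OURS. [cite: Matsumura1987, Thm. 19.3] -/
theorem isRegularLocalRing_localization_atPrime_adjoinRoot_of_under_eq (Q : Ideal R) [Q.IsPrime]
    (hMN : P.primeCompl ≤ Q.primeCompl) (g : S'[X])
    (hreg : IsRegularLocalRing (AdjoinRoot (g.map
      (@algebraMap S' (Localization.AtPrime Q) _ _ (IsLocalization.localizationAlgebraOfSubmonoidLe S'
        (Localization.AtPrime Q) P.primeCompl Q.primeCompl hMN)))))
    (P' : Ideal (AdjoinRoot g)) [P'.IsPrime] (hQ : (P'.under S').under R = Q) :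
    IsRegularLocalRing (Localization.AtPrime P') := by
  classical
  -- `R_Q` is the localisation of `S'` at the image of `R ∖ Q`
  letI algSQ : Algebra S' (Localization.AtPrime Q) :=
    IsLocalization.localizationAlgebraOfSubmonoidLe S' (Localization.AtPrime Q) P.primeCompl Q.primeCompl hMN
  haveI : IsScalarTower R S' (Localization.AtPrime Q) :=
    IsLocalization.localization_isScalarTower_of_submonoid_le S' (Localization.AtPrime Q)
      P.primeCompl Q.primeCompl hMN
  haveI hlocQ : IsLocalization (Q.primeCompl.map (algebraMap R S')) (Localization.AtPrime Q) :=
    IsLocalization.isLocalization_of_submonoid_le S' (Localization.AtPrime Q) P.primeCompl Q.primeCompl hMN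
  set g' : (Localization.AtPrime Q)[X] := g.map (algebraMap S' (Localization.AtPrime Q)) with hg'
  haveI hCreg : IsRegularLocalRing (AdjoinRoot g') := hreg
  -- polynomial rings
  letI algPoly : Algebra S'[X] (Localization.AtPrime Q)[X] := Polynomial.algebra S' (Localization.AtPrime Q)
  haveI hlocPoly : IsLocalization ((Q.primeCompl.map (algebraMap R S')).map (C : S' →+* S'[X]))
      (Localization.AtPrime Q)[X] :=
    Polynomial.isLocalization _ (Localization.AtPrime Q)
  -- the comparison map `ψ : B → C`
  have hroot : g.eval₂ ((AdjoinRoot.of g').comp (algebraMap S' (Localization.AtPrime Q))) (AdjoinRoot.root g') = 0 := by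
    rw [← Polynomial.eval₂_map, ← hg']
    exact AdjoinRoot.eval₂_root g'
  let ψ : AdjoinRoot g →+* AdjoinRoot g' :=
    AdjoinRoot.lift ((AdjoinRoot.of g').comp (algebraMap S' (Localization.AtPrime Q))) (AdjoinRoot.root g') hroot
  letI algBC : Algebra (AdjoinRoot g) (AdjoinRoot g') := ψ.toAlgebra
  have hψ : algebraMap (AdjoinRoot g) (AdjoinRoot g') = ψ := rfl
  -- `C` is the localisation of `B` at `N := image of R ∖ Q` (quotients commute with localisation)
  have H : (AdjoinRoot.mk g').comp (algebraMap S'[X] (Localization.AtPrime Q)[X]) =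
      (algebraMap (AdjoinRoot g) (AdjoinRoot g')).comp (AdjoinRoot.mk g) := by
    apply Polynomial.ringHom_ext
    · intro r
      rw [RingHom.comp_apply, RingHom.comp_apply, Polynomial.algebraMap_def, Polynomial.coe_mapRingHom,
        Polynomial.map_C, AdjoinRoot.mk_C, AdjoinRoot.mk_C, hψ]
      change _ = (AdjoinRoot.lift _ _ hroot) (AdjoinRoot.of g r)
      rw [AdjoinRoot.lift_of, RingHom.comp_apply]
    · rw [RingHom.comp_apply, RingHom.comp_apply, Polynomial.algebraMap_def, Polynomial.coe_mapRingHom,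
        Polynomial.map_X, AdjoinRoot.mk_X, AdjoinRoot.mk_X, hψ]
      change _ = (AdjoinRoot.lift _ _ hroot) (AdjoinRoot.root g)
      rw [AdjoinRoot.lift_root]
  have H' : RingHom.ker (AdjoinRoot.mk g') ≤
      (RingHom.ker (AdjoinRoot.mk g)).map (algebraMap S'[X] (Localization.AtPrime Q)[X]) := by
    have hk : RingHom.ker (AdjoinRoot.mk g) = Ideal.span {g} := Ideal.mk_ker
    have hk' : RingHom.ker (AdjoinRoot.mk g') = Ideal.span {g'} := Ideal.mk_ker
    rw [hk, hk', Ideal.map_span, Set.image_singleton, Polynomial.algebraMap_def, Polynomial.coe_mapRingHom, ← hg']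
  set N : Submonoid (AdjoinRoot g) :=
    (((Q.primeCompl.map (algebraMap R S')).map (C : S' →+* S'[X])).map (AdjoinRoot.mk g)) with hN
  haveI hlocC : IsLocalization N (AdjoinRoot g') :=
    IsLocalization.of_surjective _ (Localization.AtPrime Q)[X] (AdjoinRoot.mk g) AdjoinRoot.mk_surjective
      (AdjoinRoot.mk g') AdjoinRoot.mk_surjective H H'
  -- `N` misses `P'`
  have hdisj : Disjoint (N : Set (AdjoinRoot g)) (P' : Set (AdjoinRoot g)) := by
    rw [Set.disjoint_left]
    rintro _ ⟨_, ⟨_, ⟨x, hx, rfl⟩, rfl⟩, rfl⟩ hxP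
    apply hx
    have hmem : algebraMap S' (AdjoinRoot g) (algebraMap R S' x) ∈ P' := by
      rw [AdjoinRoot.algebraMap_eq]
      simpa [AdjoinRoot.mk_C] using hxP
    have hxQ : x ∈ (P'.under S').under R := hmem
    rw [hQ] at hxQ
    exact hxQ
  -- `P'C` is a prime over `P'`, and `B_{P'}` is the localisation of `C` at it
  haveI hP''prime : (P'.map (algebraMap (AdjoinRoot g) (AdjoinRoot g'))).IsPrime :=
    IsLocalization.isPrime_of_isPrime_disjoint N (AdjoinRoot g') P' inferInstance hdisj
  have hunder : (P'.map (algebraMap (AdjoinRoot g) (AdjoinRoot g'))).under (AdjoinRoot g) = P' :=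
    IsLocalization.under_map_of_isPrime_disjoint N (AdjoinRoot g') inferInstance hdisj
  haveI hTloc : IsLocalization.AtPrime (Localization.AtPrime (P'.map (algebraMap (AdjoinRoot g) (AdjoinRoot g'))))
      ((P'.map (algebraMap (AdjoinRoot g) (AdjoinRoot g'))).under (AdjoinRoot g)) :=
    IsLocalization.isLocalization_isLocalization_atPrime_isLocalization N
      (Localization.AtPrime (P'.map (algebraMap (AdjoinRoot g) (AdjoinRoot g'))))
      (P'.map (algebraMap (AdjoinRoot g) (AdjoinRoot g')))
  have hpc : ((P'.map (algebraMap (AdjoinRoot g) (AdjoinRoot g'))).under (AdjoinRoot g)).primeCompl =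
      P'.primeCompl := by
    ext x
    change x ∉ ((P'.map (algebraMap (AdjoinRoot g) (AdjoinRoot g'))).under (AdjoinRoot g)) ↔ x ∉ P'
    rw [hunder]
  haveI hTloc' : IsLocalization.AtPrime
      (Localization.AtPrime (P'.map (algebraMap (AdjoinRoot g) (AdjoinRoot g')))) P' := by
    change IsLocalization P'.primeCompl _
    rw [← hpc]
    exact hTloc
  -- Serre: the localisation of the regular local ring `C` at a prime is regular
  haveI hTreg : IsRegularLocalRing (Localization.AtPrime (P'.map (algebraMap (AdjoinRoot g) (AdjoinRoot g')))) :=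
    Literature.AlgebraicGeometry.Resolution.isRegularLocalRing_localization_atPrime (AdjoinRoot g') _
  -- transport along `C_{P'C} ≅ B_{P'}`
  exact IsRegularLocalRing.of_ringEquiv
    (IsLocalization.algEquiv P'.primeCompl
      (Localization.AtPrime (P'.map (algebraMap (AdjoinRoot g) (AdjoinRoot g')))) (Localization.AtPrime P')).toRingEquiv

/-- **(g2) Isolatedness from minimality.** Let `R` be a ring of prime characteristic `p`, `f ∈ R`, `P` a prime of `R`,
`S'` a localisation of `R` at `P`. If for every prime `Q < P` the torsor germ `R_Q[T]/(T^p − f)` is a regular local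
ring (no singular prime strictly below `P` — the minimality clause of `IsTopSingComponent`), then `S'[T]/(T^p − f)` has
an ISOLATED singularity: its localisation at every non-maximal prime `P'` is a regular local ring
(`HasIsolatedSingularity (RadicandRing S' p f)` unfolded). Route: `Q := P' ∩ R < P` (`under_under_lt_of_exists_lt`),
then `isRegularLocalRing_localization_atPrime_adjoinRoot_of_under_eq` at `g := T^p − f`, whose base change along
`R_P → R_Q` is `T^p − f` over `R_Q`. (The characteristic hypothesis is part of the agreed signature and is not used
by the proof.) OURS. [cite: Matsumura1987, Thm. 19.3] -/
theorem isRegularLocalRing_localization_atPrime_adjoinRoot_of_forall_lt [CharP R p]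
    (hmin : ∀ (Q : Ideal R) [Q.IsPrime], Q < P →
      IsRegularLocalRing (AdjoinRoot ((X : (Localization.AtPrime Q)[X]) ^ p -
        C (algebraMap R (Localization.AtPrime Q) f))))
    (P' : Ideal (AdjoinRoot ((X : S'[X]) ^ p - C (algebraMap R S' f)))) [P'.IsPrime]
    (hP' : ∃ Q' : Ideal (AdjoinRoot ((X : S'[X]) ^ p - C (algebraMap R S' f))), Q'.IsPrime ∧ P' < Q') :
    IsRegularLocalRing (Localization.AtPrime P') := by
  -- the prime of the base under `P'`
  have hQP : (P'.under S').under R < P := under_under_lt_of_exists_lt p f P S' P' hP'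
  obtain ⟨Q, hQdef⟩ : ∃ Q : Ideal R, (P'.under S').under R = Q := ⟨_, rfl⟩
  haveI hQprime : Q.IsPrime := hQdef ▸ (inferInstance : ((P'.under S').under R).IsPrime)
  have hQP' : Q < P := hQdef ▸ hQP
  have hMN : P.primeCompl ≤ Q.primeCompl := fun x hx hxQ => hx (hQP'.le hxQ)
  refine isRegularLocalRing_localization_atPrime_adjoinRoot_of_under_eq P S' Q hMN _ ?_ P' hQdef
  -- the base change of `T^p − f` along `R_P → R_Q` is `T^p − f`
  letI algSQ : Algebra S' (Localization.AtPrime Q) :=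
    IsLocalization.localizationAlgebraOfSubmonoidLe S' (Localization.AtPrime Q) P.primeCompl Q.primeCompl hMN
  haveI : IsScalarTower R S' (Localization.AtPrime Q) :=
    IsLocalization.localization_isScalarTower_of_submonoid_le S' (Localization.AtPrime Q)
      P.primeCompl Q.primeCompl hMN
  have hφf : algebraMap S' (Localization.AtPrime Q) (algebraMap R S' f) =
      algebraMap R (Localization.AtPrime Q) f :=
    (IsScalarTower.algebraMap_apply R S' (Localization.AtPrime Q) f).symm
  have hmapg : ((X : S'[X]) ^ p - C (algebraMap R S' f)).map (algebraMap S' (Localization.AtPrime Q)) =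
      (X : (Localization.AtPrime Q)[X]) ^ p - C (algebraMap R (Localization.AtPrime Q) f) := by
    simp only [Polynomial.map_sub, Polynomial.map_pow, Polynomial.map_X, Polynomial.map_C, hφf]
  show IsRegularLocalRing (AdjoinRoot (((X : S'[X]) ^ p - C (algebraMap R S' f)).map
    (algebraMap S' (Localization.AtPrime Q))))
  rw [hmapg]
  exact hmin Q hQP'

/-- **(g2) in the literal shape of `IsTopSingComponent`'s minimality clause.** Same conclusion as
`isRegularLocalRing_localization_atPrime_adjoinRoot_of_forall_lt`, with the hypothesis stated VERBATIM as the second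
conjunct of res-L0-w41-plan-1's `IsTopSingComponent R p f P` (`R2TwoSigma-r19.snippet.lean` §σ2 l.74, `IsSingPrime`
unfolded): «every SINGULAR prime `Q ≤ P` of the radicand — `R_Q[T]/(T^p − f)` not regular — equals `P`». Then no prime
`Q < P` is singular (classically), and the `_of_forall_lt` form applies; the conclusion is
`HasIsolatedSingularity (RadicandRing S' p f)` unfolded (snippet l.31). For the G `GeoDict` assembly (holder
res-D-pv-011): `exact GeoDict.isRegularLocalRing_localization_atPrime_adjoinRoot_of_minimal p f P S' hTop.2.1`-shape.
OURS. [cite: Matsumura1987, Thm. 19.3] -/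
theorem isRegularLocalRing_localization_atPrime_adjoinRoot_of_minimal [CharP R p]
    (hminimal : ∀ (Q : Ideal R) [Q.IsPrime],
      ¬ IsRegularLocalRing (AdjoinRoot ((X : (Localization.AtPrime Q)[X]) ^ p -
        C (algebraMap R (Localization.AtPrime Q) f))) → Q ≤ P → Q = P) :
    ∀ (P' : Ideal (AdjoinRoot ((X : S'[X]) ^ p - C (algebraMap R S' f)))) [P'.IsPrime],
      (∃ Q : Ideal (AdjoinRoot ((X : S'[X]) ^ p - C (algebraMap R S' f))), Q.IsPrime ∧ P' < Q) →
        IsRegularLocalRing (Localization.AtPrime P') :=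
  fun P' _ hP' =>
    isRegularLocalRing_localization_atPrime_adjoinRoot_of_forall_lt p f P S'
      (fun Q _ hQP => Classical.by_contradiction fun h => hQP.ne (hminimal Q h hQP.le)) P' hP'

end Summit.ResolutionOfSingularities.ResolutionOfSingularities.Theorems.SwitchingDichotomy.GeoDict

end
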